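import Summits.PneNP.PneNP.Theses.ReslinMediumCover
import Literature.Computability.MetaComplexity.ResolutionTseitinProofs

/-!
# PneNP / ReslinMediumCover — parameters of `τ(G, c) ∘ MAJ₃`
(support item stmt-PneNP-19701 `TseitinMajParams`)

Route `PneNP/ReslinMediumCover` (draft), support item `TseitinMajParams`: for a graph `G` on
`Fin N` of maximum degree `≤ D`, the lifted Tseitin contradiction `tseitinMaj G c`
(`Literature.Computability.MetaComplexity.TseitinLift`) has clause width `≤ 3D` (every clause at `u`
lists the `3 · deg(u)` lifted star variables), variable indices `< 3N²` (`numVars ≤ 3N²`: the slots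
`liftVar e i` are `< 3N²`), and at most `N · 8^D` clauses (at most `2^{3 deg(u)}` clauses per vertex,
one per violating sub-list of the star variables). Pure list bookkeeping.

References: S. K. Bhattacharya, F. Byramji, A. Chattopadhyay, R. Impagliazzo, STOC 2026, Thm 1.2
("instantiating with a 3-regular expander and 3-bit majority we get a 6-CNF"); A. Urquhart,
J. ACM 34 (1987) §4 (`2^{d-1}` clauses per vertex of degree `d`).
-/

namespace Summit.PneNP.PneNP.Theorems

-- `Summit.PneNP.PneNP` repeats a path component by design (summit = sub-problem); silence the linter.
set_option linter.dupNamespace false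

namespace TseitinMajSemantics

open Finset Literature.Computability.Complexity Literature.Computability.MetaComplexity

variable {N : ℕ} (G : SimpleGraph (Fin N)) [DecidableRel G.Adj] (c : Fin N → Bool)

/-- The neighbour list of `u` has length `deg(u)`. -/
theorem length_tseitinNeighbors (u : Fin N) : (tseitinNeighbors G u).length = G.degree u := by
  rw [← List.toFinset_card_of_nodup (nodup_tseitinNeighbors G u), ← SimpleGraph.card_neighborFinset_eq_degree,
    SimpleGraph.neighborFinset_eq_filter]
  congr 1
  ext w
  rw [List.mem_toFinset, mem_tseitinNeighbors_iff, Finset.mem_filter]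
  simp

/-- The lifted star of `u` has `3 · deg(u)` variables. -/
theorem length_liftVars (u : Fin N) : (liftVars G u).length = 3 * G.degree u := by
  rw [← length_tseitinNeighbors G u]
  unfold liftVars
  induction tseitinNeighbors G u with
  | nil => simp
  | cons w l ih => rw [List.flatMap_cons, List.length_append, ih]; simp; ring

/-- Every variable of the lifted star of `u` is a slot `< 3N²`. -/
theorem lt_of_mem_liftVars {u : Fin N} {i : ℕ} (hi : i ∈ liftVars G u) : i < 3 * N ^ 2 := by
  -- the edge numbering is `< N²`, so the slots `3 · tseitinEdgeVar e + j` (`j < 3`) are `< 3N²`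
  have hlt : ∀ (e : Sym2 (Fin N)) (j : ℕ), j < 3 → liftVar e j < 3 * N ^ 2 := by
    intro e j hj
    unfold liftVar tseitinEdgeVar
    have h1 : (e.inf : ℕ) ≤ N - 1 := Nat.le_sub_one_of_lt e.inf.isLt
    have h2 : (e.sup : ℕ) < N := e.sup.isLt
    have h3 : (e.inf : ℕ) * N ≤ (N - 1) * N := Nat.mul_le_mul_right N h1
    have h4 : (N - 1) * N + N = N ^ 2 := by
      rcases Nat.exists_eq_succ_of_ne_zero (by omega : N ≠ 0) with ⟨m, rfl⟩
      simp [pow_two, Nat.succ_mul, Nat.mul_succ]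
    omega
  unfold liftVars at hi
  rw [List.mem_flatMap] at hi
  obtain ⟨w, -, hw⟩ := hi
  simp only [List.mem_cons, List.not_mem_nil, or_false] at hw
  rcases hw with rfl | rfl | rfl
  · exact hlt _ _ (by norm_num)
  · exact hlt _ _ (by norm_num)
  · exact hlt _ _ (by norm_num)

/-- Every clause of `τ(G, c) ∘ MAJ₃` is the decorated lifted star of some vertex. -/
theorem exists_eq_map_of_mem_tseitinMaj {cl : Clause ℕ} (hcl : cl ∈ tseitinMaj G c) :
    ∃ u : Fin N, ∃ T : List ℕ, cl = (liftVars G u).map fun i => (i, decide (i ∉ T)) := by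
  unfold tseitinMaj at hcl
  rw [List.mem_flatMap] at hcl
  obtain ⟨u, -, hu⟩ := hcl
  unfold tseitinMajVertexClauses at hu
  rw [List.mem_map] at hu
  obtain ⟨T, -, rfl⟩ := hu
  exact ⟨u, T, rfl⟩

/-- At most `2^{3 deg(u)}` clauses at `u`. -/
theorem length_tseitinMajVertexClauses_le (u : Fin N) :
    (tseitinMajVertexClauses G c u).length ≤ 2 ^ (3 * G.degree u) := by
  unfold tseitinMajVertexClauses
  rw [List.length_map, ← length_liftVars G u, ← List.length_sublists]
  exact List.length_filter_le _ _

/-- The sum of a list of naturals each `≤ B` is `≤ length · B`. -/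
theorem sum_map_le_length_mul {α : Type*} (l : List α) (f : α → ℕ) {B : ℕ} (h : ∀ a ∈ l, f a ≤ B) :
    (l.map f).sum ≤ l.length * B := by
  induction l with
  | nil => simp
  | cons a l ih =>
    rw [List.map_cons, List.sum_cons, List.length_cons]
    have h1 := h a (by simp)
    have h2 := ih fun a' ha' => h a' (by simp [ha'])
    nlinarith

end TseitinMajSemantics

open Literature.Computability.Complexity Literature.Computability.MetaComplexity in
/-- **Parameters of `τ(G, c) ∘ MAJ₃`** — support item `TseitinMajParams` of route
PneNP/ReslinMediumCover (stmt-PneNP-19701): for maximum degree `≤ D`, the lifted Tseitin formula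
has width `≤ 3D`, `numVars ≤ 3N²`, and at most `N · 8^D` clauses. [Bhattacharya et al. 2026,
Thm 1.2; Urquhart 1987, §4] -/
theorem tseitinMajParams_proof : Summit.PneNP.PneNP.Theses.ReslinMediumCover.TseitinMajParams := by
  intro N D G _ c hdeg
  refine ⟨?_, ?_, ?_⟩
  · -- width
    intro cl hcl
    obtain ⟨u, T, rfl⟩ := TseitinMajSemantics.exists_eq_map_of_mem_tseitinMaj G c hcl
    rw [List.length_map, TseitinMajSemantics.length_liftVars]
    exact Nat.mul_le_mul_left 3 (hdeg u)
  · -- numVars (`foldr max 0` is bounded by a common bound of the entries, cf.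
    -- `Literature.Computability.AlgebraicComplexity.DepthReduction.foldr_max_le`)
    unfold CNF.numVars
    have hfold : ∀ (l : List ℕ) (b : ℕ), (∀ x ∈ l, x ≤ b) → l.foldr max 0 ≤ b := by
      intro l b h
      induction l with
      | nil => exact Nat.zero_le _
      | cons a l ih =>
        rw [List.foldr_cons]
        exact max_le (h a (by simp)) (ih fun x hx => h x (by simp [hx]))
    apply hfold
    intro x hx
    rw [List.mem_map] at hx
    obtain ⟨l, hl, rfl⟩ := hx
    rw [List.mem_flatten] at hl
    obtain ⟨cl, hcl, hlcl⟩ := hl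
    obtain ⟨u, T, rfl⟩ := TseitinMajSemantics.exists_eq_map_of_mem_tseitinMaj G c hcl
    rw [List.mem_map] at hlcl
    obtain ⟨i, hi, rfl⟩ := hlcl
    exact TseitinMajSemantics.lt_of_mem_liftVars G hi
  · -- number of clauses
    unfold tseitinMaj
    rw [List.length_flatMap]
    have h := TseitinMajSemantics.sum_map_le_length_mul (List.finRange N)
      (fun u => (tseitinMajVertexClauses G c u).length) (B := 8 ^ D) (fun u _ => ?_)
    · rw [List.length_finRange] at h
      exact h
    · refine (TseitinMajSemantics.length_tseitinMajVertexClauses_le G c u).trans ?_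
      rw [show (8 : ℕ) = 2 ^ 3 by norm_num, ← pow_mul]
      exact Nat.pow_le_pow_right (by norm_num) (Nat.mul_le_mul_left 3 (hdeg u))

end Summit.PneNP.PneNP.Theorems
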